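import Mathlib
import Literature.Analysis.OperatorTheory.SchurTestKernel
import HarnessLib

/-!
# Fibred Born–Oppenheimer blocks by Cauchy–Schwarz in the kinetic Gram form (abstract, model side of the RATE twin)
# (route `FlatTubeReduction`, crux K1 `NearFlatRatioLaw` stmt-QuantumFields-24720, registered stub `stub_boRate` = FCL 23943's `BORateAll`;
# rung R2b1 = RECORD-label femto gap; no summit statement is proved here)

Seat `ym-line-ftr-p1` g6 (prover).  The registered stub `stub_boRate` asks, for a 2-family supported near the flat orbits, for an ADIABATIC SPLIT
`ψ = φ + χ` with (P1) almost-orthogonality, (P3) a stiff gap on `χ`, (P4) a SECOND-ORDER cross term, (P5) the diagonal `⟨φ,Kφ⟩` bounded by the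
ONE-SITE form of a dressed slow profile `g`, (P6) the dressing cost — all at tolerance `C·λ_b(L³β)²`.  Route RED lane A's abstract layer
(`…TwistedTraceScalingInnerModelBlocks/…InnerModelPerturbed`, ns `…FemtoTransferGap.Mehler`) proves such blocks for the VACUUM-FROZEN tensor model
`k(c,c')·K_Mehler(q,q')` (fibre stiffness independent of the slow variable `c`), which caps the precision at the first order in the slow amplitude
(g5 memo `rate-twin-readiness-g5.md`, finding (A)).  The rate twin needs the `c`-FROZEN (fibred) model: slow kernel `k(c,c')` times a kinetic GRAM
kernel in the fast variable whose two ends carry `c`- resp. `c'`-dependent fibre weights.  This file proves the four blocks for that model in complete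
generality — ANY σ-finite slow space `(C,ν)`, fast space `(Q,π)` and Gram space `(Z,ρ)`, any «half-kernel» `s : C → Q → Z → ℝ` (think
`s(c,q,z) = e^{−V_c(q)/2}·e^{−2b|q−z|²}`, so that `∫ s(c,q,z)s(c',q',z)dz ∝ e^{−V_c(q)/2}e^{−b|q−q'|²}e^{−V_{c'}(q')/2}`), any nonnegative slow kernel `k`:
* `halfT`, `fibrePair`, `fibreEnergy`, `fibredForm` — `(S_c h)(z) = ∫ s(c,q,z)h(q)dπ`, `B_{c,c'}(h,h') = ∫ S_c h · S_{c'} h' dρ`, `E_c(h) = B_{c,c}(h,h)`,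
  `T(Φ,Ψ) = ∫∫ k(c,c')·B_{c,c'}(Φ_c,Ψ_{c'}) dν dν` (the quadratic form of the fibred kernel, written in Gram form);
* ★★ `abs_fibredForm_le` — MASTER INEQUALITY (Cauchy–Schwarz in `L²(ρ)` fibre pair by fibre pair):
  `|T(Φ,Ψ)| ≤ ∫∫ k(c,c')·√E_c(Φ_c)·√E_{c'}(Ψ_{c'})` — the fibred form is dominated by the SLOW form of the fibrewise energy profiles;
* ★★ `fibredForm_prod_le` — DIAGONAL block (P5)+(P6) in model form, for EVERY slow profile `f` and EVERY fibre profile `Ω_c`: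
  `T(f⊗Ω, f⊗Ω) ≤ ∫∫ g(c)k(c,c')g(c')` with `g = |f|·√λ`, `λ(c) = E_c(Ω_c)` — the frozen fibre energy (zero-point energy `e^{−E_st(c)}`, anharmonic
  corrections included) is CARRIED inside the one-site comparison function with its sign, never bounded (g5 finding (B); FCL `Cruxes/FixedLatticeLaw/Lines/rate.md`
  RATE POINT 2/2′);
* ★★ `fibredForm_le_of_fibreGap` — STIFF block (P3): a uniform fibrewise bound `E_c(χ_c) ≤ Λ₁‖χ_c‖²` and a row bound `r` for `k` give `T(χ,χ) ≤ Λ₁·r·‖χ‖²`;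
* the CROSS block (P4) `T(f⊗Ω,χ)² ≤ Λ₁·r·(∫ f²τ)·‖χ‖²` (transport defect `τ`) and (P1) are the sequel `…FlatTubeReductionFibredBOCross`.
Integrability side conditions are hypotheses on the relevant product integrands (as in `Literature.Analysis.OperatorTheory.SchurTestKernel`); the chart
that supplies `k`, `s`, `Ω`, `λ`, `Λ₁`, `τ` for the lattice transfer operator is OPEN (route RED lane A C4-CORE + the rate twin, `Cruxes/NearFlatRatioLaw/Lines/borate.md`).
HONEST FRAMING: elementary measure theory (Cauchy–Schwarz, Fubini, Schur) for the registered stub of a crux of the CONDITIONAL reduction route to the femto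
rung R2b1 (RECORD label); nothing here is infinite volume, a continuum limit or the Clay mass gap.  No named facts, no `sorry`.

## References
* B. Helffer, *Spectral Theory and its Applications*, CUP 2013, Lemma 7.1 (Schur's test) — [cite: Helffer2013, Lemma 7.1 pp.77–78].
* S. J. Gustafson, I. M. Sigal, *Mathematical Concepts of Quantum Mechanics*, Springer 2003, §11–§12 (Feshbach map, Born–Oppenheimer) — [cite: GustafsonSigal2003, §12].
* M. Lüscher, Nucl. Phys. B219 (1983) 233, §3 — [cite: Luscher1983, §3].
-/

set_option autoImplicit false

noncomputable section

open MeasureTheory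
open scoped RealInnerProductSpace

namespace Summit.QuantumFields.YangMills.Theorems.FemtoTransferGap.FibredBO

variable {C Q Z : Type*} [MeasurableSpace C] [MeasurableSpace Q] [MeasurableSpace Z]

/-! ## Cauchy–Schwarz in `L²(ρ)` (real functions) -/

section CS

variable {ρ : Measure Z}

/-- `‖toLp u‖ = √(∫ u²)` for a real `L²` function. [folklore] -/
theorem norm_toLp_eq_sqrt {u : Z → ℝ} (hu : MemLp u 2 ρ) : ‖hu.toLp u‖ = Real.sqrt (∫ z, u z ^ 2 ∂ρ) := by
  have h : ⟪hu.toLp u, hu.toLp u⟫ = ∫ z, u z ^ 2 ∂ρ := by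
    rw [L2.inner_def]
    refine integral_congr_ae ?_
    filter_upwards [hu.coeFn_toLp] with z hz
    rw [hz, real_inner_self_eq_norm_sq, Real.norm_eq_abs, sq_abs]
  rw [← h, real_inner_self_eq_norm_sq, Real.sqrt_sq (norm_nonneg _)]

/-- **Cauchy–Schwarz**: `|∫ u v| ≤ √(∫u²)·√(∫v²)` for real `u, v ∈ L²(ρ)`. [folklore] -/
theorem abs_integral_mul_le_sqrt_mul_sqrt {u v : Z → ℝ} (hu : MemLp u 2 ρ) (hv : MemLp v 2 ρ) :
    |∫ z, u z * v z ∂ρ| ≤ Real.sqrt (∫ z, u z ^ 2 ∂ρ) * Real.sqrt (∫ z, v z ^ 2 ∂ρ) := by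
  have hinner : ⟪hu.toLp u, hv.toLp v⟫ = ∫ z, u z * v z ∂ρ := by
    rw [L2.inner_def]
    refine integral_congr_ae ?_
    filter_upwards [hu.coeFn_toLp, hv.coeFn_toLp] with z hz hz'
    rw [hz, hz', real_inner_comm, RCLike.inner_apply, conj_trivial]
  rw [← hinner, ← norm_toLp_eq_sqrt hu, ← norm_toLp_eq_sqrt hv]
  exact abs_real_inner_le_norm _ _

end CS

/-! ## The fibred objects -/

section Defs

variable (π : Measure Q) (ρ : Measure Z) (s : C → Q → Z → ℝ)

/-- Half-transform of a fibre function at the slow point `c`: `(S_c h)(z) = ∫ s(c,q,z)·h(q) dπ(q)`. -/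
def halfT (c : C) (h : Q → ℝ) (z : Z) : ℝ := ∫ q, s c q z * h q ∂π

/-- Fibre pairing between the slow points `c, c'`: `B_{c,c'}(h,h') = ∫ (S_c h)(z)·(S_{c'} h')(z) dρ(z)` — the `(c,c')` matrix element of the kinetic
Gram kernel `∫ s(c,q,z)s(c',q',z)dρ(z)` between the fibre functions `h` (over `c`) and `h'` (over `c'`). -/
def fibrePair (c c' : C) (h h' : Q → ℝ) : ℝ := ∫ z, halfT π s c h z * halfT π s c' h' z ∂ρ

/-- Frozen fibre energy at `c`: `E_c(h) = B_{c,c}(h,h) = ‖S_c h‖²_{L²(ρ)}` — the quadratic form of the FROZEN fibre kernel `K_c(q,q') = ∫ s(c,q,z)s(c,q',z)dρ`. -/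
def fibreEnergy (c : C) (h : Q → ℝ) : ℝ := ∫ z, halfT π s c h z ^ 2 ∂ρ

end Defs

/-- The fibred form: `T(Φ,Ψ) = ∫∫ k(c,c')·B_{c,c'}(Φ(c,·),Ψ(c',·)) dν(c') dν(c)` — the quadratic form of the fibred kernel
`K((c,q),(c',q')) = k(c,c')·∫ s(c,q,z)s(c',q',z)dρ(z)` on `C × Q`, written in Gram form. -/
def fibredForm (ν : Measure C) (π : Measure Q) (ρ : Measure Z) (k : C → C → ℝ) (s : C → Q → Z → ℝ) (Φ Ψ : C × Q → ℝ) : ℝ :=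
  ∫ c, ∫ c', k c c' * fibrePair π ρ s c c' (fun q => Φ (c, q)) (fun q => Ψ (c', q)) ∂ν ∂ν

variable {ν : Measure C} {π : Measure Q} {ρ : Measure Z} [SFinite ν] [SFinite π] [SFinite ρ]
variable {k : C → C → ℝ} {s : C → Q → Z → ℝ}

/-! ## Elementary properties -/

omit [MeasurableSpace C] [MeasurableSpace Z] [SFinite π] in
/-- `S_c (a·h) = a·S_c h`. [folklore] -/
theorem halfT_const_mul (c : C) (a : ℝ) (h : Q → ℝ) (z : Z) :
    halfT π s c (fun q => a * h q) z = a * halfT π s c h z := by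
  unfold halfT
  rw [← integral_const_mul]
  refine integral_congr_ae (ae_of_all _ fun q => ?_)
  ring

omit [MeasurableSpace C] [SFinite π] [SFinite ρ] in
/-- `E_c(h) = B_{c,c}(h,h)`. [folklore] -/
theorem fibreEnergy_eq_fibrePair (c : C) (h : Q → ℝ) : fibreEnergy π ρ s c h = fibrePair π ρ s c c h h := by
  unfold fibreEnergy fibrePair
  refine integral_congr_ae (ae_of_all _ fun z => ?_)
  ring

omit [MeasurableSpace C] [SFinite π] [SFinite ρ] in
/-- `0 ≤ E_c(h)`. [folklore] -/
theorem fibreEnergy_nonneg (c : C) (h : Q → ℝ) : 0 ≤ fibreEnergy π ρ s c h :=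
  integral_nonneg fun _ => sq_nonneg _

omit [MeasurableSpace C] [SFinite π] [SFinite ρ] in
/-- `E_c(a·h) = a²·E_c(h)`. [folklore] -/
theorem fibreEnergy_const_mul (c : C) (a : ℝ) (h : Q → ℝ) :
    fibreEnergy π ρ s c (fun q => a * h q) = a ^ 2 * fibreEnergy π ρ s c h := by
  unfold fibreEnergy
  rw [← integral_const_mul]
  refine integral_congr_ae (ae_of_all _ fun z => ?_)
  dsimp only
  rw [halfT_const_mul]
  ring

omit [MeasurableSpace C] [SFinite π] [SFinite ρ] in
/-- **Fibre Cauchy–Schwarz**: `|B_{c,c'}(h,h')| ≤ √E_c(h)·√E_{c'}(h')` whenever the two half-transforms are in `L²(ρ)`. [folklore] -/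
theorem abs_fibrePair_le (c c' : C) (h h' : Q → ℝ) (hh : MemLp (halfT π s c h) 2 ρ) (hh' : MemLp (halfT π s c' h') 2 ρ) :
    |fibrePair π ρ s c c' h h'| ≤ Real.sqrt (fibreEnergy π ρ s c h) * Real.sqrt (fibreEnergy π ρ s c' h') :=
  abs_integral_mul_le_sqrt_mul_sqrt hh hh'

/-! ## The master inequality -/

omit [SFinite π] [SFinite ρ] in
/-- ★★ **MASTER INEQUALITY (Cauchy–Schwarz fibre pair by fibre pair)**: for a nonnegative slow kernel `k`,
`|T(Φ,Ψ)| ≤ ∫∫ k(c,c')·√E_c(Φ_c)·√E_{c'}(Ψ_{c'}) dν dν` — the fibred form is dominated by the SLOW form of the two fibrewise energy profiles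
`a(c) = √E_c(Φ(c,·))`, `b(c') = √E_{c'}(Ψ(c',·))`.  Hypotheses: the half-transforms are in `L²(ρ)` for every slow point, and the two `(c,c')`-integrands
are product-integrable. [folklore] [cite: Helffer2013, Lemma 7.1 pp.77–78] -/
theorem abs_fibredForm_le (hk : ∀ c c', 0 ≤ k c c') {Φ Ψ : C × Q → ℝ}
    (hΦ : ∀ c, MemLp (halfT π s c fun q => Φ (c, q)) 2 ρ) (hΨ : ∀ c, MemLp (halfT π s c fun q => Ψ (c, q)) 2 ρ)
    (hI : Integrable (fun p : C × C => k p.1 p.2 * fibrePair π ρ s p.1 p.2 (fun q => Φ (p.1, q)) (fun q => Ψ (p.2, q))) (ν.prod ν))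
    (hJ : Integrable (fun p : C × C => k p.1 p.2 * (Real.sqrt (fibreEnergy π ρ s p.1 fun q => Φ (p.1, q)) *
      Real.sqrt (fibreEnergy π ρ s p.2 fun q => Ψ (p.2, q)))) (ν.prod ν)) :
    |fibredForm ν π ρ k s Φ Ψ| ≤
      ∫ c, ∫ c', k c c' * (Real.sqrt (fibreEnergy π ρ s c fun q => Φ (c, q)) * Real.sqrt (fibreEnergy π ρ s c' fun q => Ψ (c', q))) ∂ν ∂ν := by
  unfold fibredForm
  rw [integral_integral hI, integral_integral hJ]
  refine (abs_integral_le_integral_abs).trans (integral_mono hI.abs hJ fun p => ?_)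
  dsimp only
  rw [abs_mul, abs_of_nonneg (hk p.1 p.2)]
  exact mul_le_mul_of_nonneg_left (abs_fibrePair_le _ _ _ _ (hΦ p.1) (hΨ p.2)) (hk p.1 p.2)

/-! ## DIAGONAL block: the frozen fibre energy is carried inside the slow comparison function -/

omit [SFinite π] [SFinite ρ] in
/-- ★★ **DIAGONAL block (the door's (P5)+(P6) in model form), for EVERY slow profile `f` and EVERY fibre profile `Ω_c`**: with `λ(c) = E_c(Ω_c)` (the frozen
fibre energy of the profile; for the frozen top eigenfunction this is `e^{−E_st(c)}`, zero-point energy with ALL anharmonic corrections) and the dressed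
slow comparison function `g = |f|·√λ`:  `T(f⊗Ω, f⊗Ω) ≤ ∫∫ g(c)·k(c,c')·g(c') dν dν`.  No smallness, no sign condition, no expansion: the zero-point energy is
CARRIED inside `g` (RATE POINT 2′ of `Cruxes/FixedLatticeLaw/Lines/rate.md`; finding (B) of the ftr-p1 g5 memo). [folklore] [cite: Luscher1983, §3] [cite: GustafsonSigal2003, §12] -/
theorem fibredForm_prod_le (hk : ∀ c c', 0 ≤ k c c') (f : C → ℝ) (Ω : C → Q → ℝ)
    (hΩ : ∀ c, MemLp (halfT π s c (Ω c)) 2 ρ)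
    (hI : Integrable (fun p : C × C => k p.1 p.2 *
      fibrePair π ρ s p.1 p.2 (fun q => f p.1 * Ω p.1 q) (fun q => f p.2 * Ω p.2 q)) (ν.prod ν))
    (hJ : Integrable (fun p : C × C => k p.1 p.2 * ((|f p.1| * Real.sqrt (fibreEnergy π ρ s p.1 (Ω p.1))) *
      (|f p.2| * Real.sqrt (fibreEnergy π ρ s p.2 (Ω p.2))))) (ν.prod ν)) :
    fibredForm ν π ρ k s (fun x => f x.1 * Ω x.1 x.2) (fun x => f x.1 * Ω x.1 x.2) ≤
      ∫ c, ∫ c', k c c' * ((|f c| * Real.sqrt (fibreEnergy π ρ s c (Ω c))) * (|f c'| * Real.sqrt (fibreEnergy π ρ s c' (Ω c')))) ∂ν ∂ν := by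
  have hsq : ∀ c, Real.sqrt (fibreEnergy π ρ s c fun q => f c * Ω c q) = |f c| * Real.sqrt (fibreEnergy π ρ s c (Ω c)) := by
    intro c
    rw [fibreEnergy_const_mul, Real.sqrt_mul (sq_nonneg _), Real.sqrt_sq_eq_abs]
  have hmem : ∀ c, MemLp (halfT π s c fun q => f c * Ω c q) 2 ρ := by
    intro c
    have : (halfT π s c fun q => f c * Ω c q) = fun z => f c * halfT π s c (Ω c) z := funext fun z => halfT_const_mul c (f c) (Ω c) z
    rw [this]
    exact (hΩ c).const_mul (f c)
  have hJ' : Integrable (fun p : C × C => k p.1 p.2 * (Real.sqrt (fibreEnergy π ρ s p.1 fun q => f p.1 * Ω p.1 q) *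
      Real.sqrt (fibreEnergy π ρ s p.2 fun q => f p.2 * Ω p.2 q))) (ν.prod ν) := by
    refine hJ.congr (ae_of_all _ fun p => ?_)
    dsimp only
    rw [hsq, hsq]
  have h := abs_fibredForm_le (ν := ν) (Φ := fun x => f x.1 * Ω x.1 x.2) (Ψ := fun x => f x.1 * Ω x.1 x.2) hk hmem hmem hI hJ'
  refine (le_abs_self _).trans (h.trans (le_of_eq ?_))
  refine integral_congr_ae (ae_of_all _ fun c => integral_congr_ae (ae_of_all _ fun c' => ?_))
  dsimp only
  rw [hsq, hsq]

/-! ## STIFF block: a uniform fibrewise gap passes to the fibred form through Schur's test on the slow space -/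

omit [SFinite ρ] in
/-- ★★ **STIFF block (the door's (P3) in model form)**: if every fibre of `χ` has frozen energy at most `Λ₁` times its `L²(π)` mass —
`E_c(χ(c,·)) ≤ Λ₁·∫ χ(c,q)² dπ` (for the frozen top eigenfunction `Ω_c` with eigenvalue `λ(c)`, fibre gap `γ(c)` and `χ(c,·) ⊥ Ω_c` one takes
`Λ₁ = sup_c λ(c)(1−γ(c))`) — and the symmetric nonnegative slow kernel has row integrals `≤ r`, then `T(χ,χ) ≤ Λ₁·r·‖χ‖²_{L²(ν⊗π)}`.
[folklore] [cite: Helffer2013, Lemma 7.1 pp.77–78] -/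
theorem fibredForm_le_of_fibreGap (hk : ∀ c c', 0 ≤ k c c') (hksymm : ∀ c c', k c c' = k c' c) {r Λ₁ : ℝ} (hΛ₁ : 0 ≤ Λ₁)
    (hrow : ∀ᵐ c ∂ν, ∫ c', k c c' ∂ν ≤ r) {χ : C × Q → ℝ} (hχ2 : Integrable (fun x => χ x ^ 2) (ν.prod π))
    (hχ : ∀ c, MemLp (halfT π s c fun q => χ (c, q)) 2 ρ)
    (hgap : ∀ c, fibreEnergy π ρ s c (fun q => χ (c, q)) ≤ Λ₁ * ∫ q, χ (c, q) ^ 2 ∂π)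
    (hI : Integrable (fun p : C × C => k p.1 p.2 * fibrePair π ρ s p.1 p.2 (fun q => χ (p.1, q)) (fun q => χ (p.2, q))) (ν.prod ν))
    (hJ : Integrable (fun p : C × C => k p.1 p.2 * (Real.sqrt (fibreEnergy π ρ s p.1 fun q => χ (p.1, q)) *
      Real.sqrt (fibreEnergy π ρ s p.2 fun q => χ (p.2, q)))) (ν.prod ν))
    (hS : Integrable (fun p : C × C => Real.sqrt (∫ q, χ (p.1, q) ^ 2 ∂π) * k p.1 p.2 * Real.sqrt (∫ q, χ (p.2, q) ^ 2 ∂π)) (ν.prod ν))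
    (hS₁ : Integrable (fun p : C × C => k p.1 p.2 * Real.sqrt (∫ q, χ (p.1, q) ^ 2 ∂π) ^ 2) (ν.prod ν))
    (hS₂ : Integrable (fun p : C × C => k p.1 p.2 * Real.sqrt (∫ q, χ (p.2, q) ^ 2 ∂π) ^ 2) (ν.prod ν)) :
    fibredForm ν π ρ k s χ χ ≤ Λ₁ * r * ∫ x, χ x ^ 2 ∂(ν.prod π) := by
  -- fibrewise mass profile
  set m : C → ℝ := fun c => Real.sqrt (∫ q, χ (c, q) ^ 2 ∂π) with hm
  have hm0 : ∀ c, 0 ≤ ∫ q, χ (c, q) ^ 2 ∂π := fun c => integral_nonneg fun _ => sq_nonneg _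
  have hmsq : ∀ c, m c ^ 2 = ∫ q, χ (c, q) ^ 2 ∂π := fun c => Real.sq_sqrt (hm0 c)
  -- √E_c(χ_c) ≤ √Λ₁ · m c
  have hE : ∀ c, Real.sqrt (fibreEnergy π ρ s c fun q => χ (c, q)) ≤ Real.sqrt Λ₁ * m c := by
    intro c
    rw [hm, ← Real.sqrt_mul hΛ₁]
    exact Real.sqrt_le_sqrt (hgap c)
  -- master inequality, then the pointwise bound
  have h1 := abs_fibredForm_le (ν := ν) hk hχ hχ hI hJ
  have h2 : ∫ c, ∫ c', k c c' * (Real.sqrt (fibreEnergy π ρ s c fun q => χ (c, q)) *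
      Real.sqrt (fibreEnergy π ρ s c' fun q => χ (c', q))) ∂ν ∂ν ≤ ∫ c, ∫ c', Λ₁ * (m c * k c c' * m c') ∂ν ∂ν := by
    have hS' : Integrable (fun p : C × C => Λ₁ * (m p.1 * k p.1 p.2 * m p.2)) (ν.prod ν) := hS.const_mul Λ₁
    rw [integral_integral hJ, integral_integral hS']
    refine integral_mono hJ hS' fun p => ?_
    dsimp only
    have hkp := hk p.1 p.2
    have ha := hE p.1
    have hb := hE p.2
    have ha0 : 0 ≤ Real.sqrt (fibreEnergy π ρ s p.1 fun q => χ (p.1, q)) := Real.sqrt_nonneg _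
    have hb0 : 0 ≤ Real.sqrt (fibreEnergy π ρ s p.2 fun q => χ (p.2, q)) := Real.sqrt_nonneg _
    have hmm : Real.sqrt (fibreEnergy π ρ s p.1 fun q => χ (p.1, q)) * Real.sqrt (fibreEnergy π ρ s p.2 fun q => χ (p.2, q)) ≤
        (Real.sqrt Λ₁ * m p.1) * (Real.sqrt Λ₁ * m p.2) := mul_le_mul ha hb hb0 (ha0.trans ha)
    have hΛ : Real.sqrt Λ₁ * Real.sqrt Λ₁ = Λ₁ := Real.mul_self_sqrt hΛ₁
    calc k p.1 p.2 * (Real.sqrt (fibreEnergy π ρ s p.1 fun q => χ (p.1, q)) * Real.sqrt (fibreEnergy π ρ s p.2 fun q => χ (p.2, q)))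
        ≤ k p.1 p.2 * ((Real.sqrt Λ₁ * m p.1) * (Real.sqrt Λ₁ * m p.2)) := mul_le_mul_of_nonneg_left hmm hkp
      _ = Λ₁ * (m p.1 * k p.1 p.2 * m p.2) := by linear_combination (k p.1 p.2 * m p.1 * m p.2) * hΛ
  -- Schur on the slow space for the mass profile
  have h3 : ∫ c, ∫ c', m c * k c c' * m c' ∂ν ∂ν ≤ r * ∫ c, m c ^ 2 ∂ν := by
    have hmint : Integrable (fun c => m c ^ 2) ν := by
      refine (hχ2.integral_prod_left).congr (ae_of_all _ fun c => ?_)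
      dsimp only
      rw [hmsq]
    exact Literature.Analysis.OperatorTheory.SchurTest.integral_integral_mul_kernel_mul_self_le_of_symm k m hk hksymm hrow hmint hS hS₁ hS₂
  have h4 : ∫ c, m c ^ 2 ∂ν = ∫ x, χ x ^ 2 ∂(ν.prod π) := by
    rw [integral_prod _ hχ2]
    refine integral_congr_ae (ae_of_all _ fun c => ?_)
    dsimp only
    rw [hmsq]
  have h5 : ∫ c, ∫ c', Λ₁ * (m c * k c c' * m c') ∂ν ∂ν = Λ₁ * ∫ c, ∫ c', m c * k c c' * m c' ∂ν ∂ν := by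
    rw [← integral_const_mul]
    refine integral_congr_ae (ae_of_all _ fun c => ?_)
    dsimp only
    rw [integral_const_mul]
  calc fibredForm ν π ρ k s χ χ ≤ |fibredForm ν π ρ k s χ χ| := le_abs_self _
    _ ≤ _ := h1
    _ ≤ ∫ c, ∫ c', Λ₁ * (m c * k c c' * m c') ∂ν ∂ν := h2
    _ = Λ₁ * ∫ c, ∫ c', m c * k c c' * m c' ∂ν ∂ν := h5
    _ ≤ Λ₁ * (r * ∫ c, m c ^ 2 ∂ν) := mul_le_mul_of_nonneg_left h3 hΛ₁
    _ = Λ₁ * r * ∫ x, χ x ^ 2 ∂(ν.prod π) := by rw [h4]; ring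

end Summit.QuantumFields.YangMills.Theorems.FemtoTransferGap.FibredBO

end
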